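import Literature.RepresentationTheory.HeisenbergGroup.SchrodingerGaloisTwist
import Literature.NumberTheory.GelbartRogawski1991.LocalUnitarySplittingDatum
import HarnessLib

/-!
# Galois twist of the LOCAL Schrödinger package at a finite place: `S̃p_{ψ_v}(𝕎_v) →* S̃p_{ψ_v(κ·)}(𝕎_v)`

Topic `NumberTheory/GelbartRogawski1991`; namespace `Literature.NumberTheory.GelbartRogawski1991.UnitaryDualPair.LocalSplitting`
(the namespace of `LocalUnitarySplittingDatum.lean`, whose objects `localSchrodinger F N T v`, `LocalMp F N T v`,
`iota` are twisted here).  KERNEL ONLY: definitions with bodies and proved theorems; no named fact, no `sorry`.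

The instance of `HeisenbergGroup/SchrodingerGaloisTwist.lean` at the local package of a finite place `v` of the
number field `F` (Gram matrix `T ∈ Sym_N(F)`, `𝕎_v = F_vᴺ × F_vᴺ`, `ψ_v = adeleAddCharAt F v`): for a pair of
mutually inverse field endomorphisms `τ, τ'` of `ℂ` (an automorphism `σ` and `σ⁻¹`, as plain ring homomorphisms)
and a scalar `κ ∈ F_v` with **`τ ∘ ψ_v = ψ_v(κ ·)`** (for `σ ∈ Aut(ℂ)` this holds with `κ = χ_cyc(σ)` read in
`𝒪_v`, the arithmetic input supplied by `Automorphic/AdelicAdditiveCharacterGaloisTwist.lean` of the cell's road;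
here `κ` and the identity are HYPOTHESES), we record:
* §1 the `κ`-shifted local package `localSchrodingerMulShift F N T v κ = schrodingerSB β_{𝕋_v} (ψ_v.mulShift κ)`
  and its group of pairs `LocalMpMulShift F N T v κ` (the CARRIER consumed by the `ψ_v(κ·) ↔ ⟨κ a⟩` dictionary of the
  road, piece P4);
* §2 **`LocalMp.galTwist … : LocalMp F N T v →* LocalMpMulShift F N T v κ`**, over the identity of `Sp(𝕎_v)`
  (`LocalMp.proj_galTwist`), bijective, with `ω(galTwist p)(τ ∘ f) = τ ∘ (ω(p) f)`;
* §3 for a splitting `s : U(J)(F_v) →* LocalMp F N T v` over `ι_v` (`hs`), the twisted splitting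
  `galTwist ∘ s : U(J)(F_v) →* LocalMpMulShift F N T v κ` is again over `ι_v` (`proj_galTwist_comp_eq_iota`), its Weil
  representation is the `τ`-twist of `ω_s` (`toRep_galTwist_comp_apply'`), and it is smooth when `ω_s` is
  (`isSmooth_galTwist_comp'`) — i.e. «the `σ`-twist of a smooth splitting datum at `ψ_v` is a smooth splitting datum
  at `ψ_v(κ·)` over the same `ι_v`», which is what the ε-rigidity road ([Liu2021, Thm 4.18 (3)], proof l. 2272–2289)
  consumes at each finite place (piece P3a of the road memo of the cell `hodgecm-mathlib`, A-p19 v2, 2026-08-28).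
HC_CM is proved only modulo the 7 printed citations until rung 0 of the ladder closes; nothing about it is claimed here.

## References
* [MoeglinVignerasWaldspurger1987] C. Mœglin, M.-F. Vignéras, J.-L. Waldspurger, *Correspondances de Howe sur un corps
  p-adique*, LNM 1291 (1987), Chap. 2 II.1 (B) (group of pairs; transport of structure), Chap. 3 I.3.
* [Liu2021] Y. Liu, Camb. J. Math. 9 (2021), Thm. 4.18 (3), proof l. 2272–2289 («`σ` replaces `ψ` by `ψ(χ_cyc(σ)·)`»).
-/

set_option autoImplicit false

noncomputable section

open NumberField IsDedekindDomain Matrix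
open Literature.RepresentationTheory.HeisenbergGroup
open Literature.NumberTheory.Automorphic
open Literature.NumberTheory.GaloisRepresentations.IsNonarchimedeanLocalField

namespace Literature.NumberTheory.GelbartRogawski1991.UnitaryDualPair.LocalSplitting

variable (F : Type) [Field F] [NumberField F] (N : ℕ) (T : Matrix (Fin N) (Fin N) F) (v : HeightOneSpectrum (𝓞 F))

/-! ## §1 The `κ`-shifted local Schrödinger package -/

/-- `β_{𝕋_v}(·, y)` is continuous (a linear form on `F_vᴺ`; local copy of the private lemma of
`LocalUnitarySplittingDatum`). [folklore] -/
private theorem continuous_localPairing_left' (y : Fin N → v.adicCompletion F) :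
    Continuous fun u : Fin N → v.adicCompletion F => localPairing F N T v u y := by
  simp only [Matrix.toLinearMap₂'_apply', dotProduct]
  exact continuous_finsetSum _ fun i _ => (continuous_apply i).mul continuous_const

/-- the shifted character `ψ_v(κ ·)` is locally constant (`ψ_v` is, and `x ↦ κ x` is continuous).
[cite: MoeglinVignerasWaldspurger1987, Chap. 2 I.2] -/
theorem isLocallyConstant_adeleAddCharAt_mulShift (κ : v.adicCompletion F) :
    IsLocallyConstant (⇑((adeleAddCharAt F v).mulShift κ) : v.adicCompletion F → Circle) := by
  have e : (⇑((adeleAddCharAt F v).mulShift κ) : v.adicCompletion F → Circle) =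
      (⇑(adeleAddCharAt F v) : v.adicCompletion F → Circle) ∘ fun x => κ * x := by
    funext x
    exact AddChar.mulShift_apply
  rw [e]
  exact (isLocallyConstant_of_isContinuousNontrivial (isContinuousNontrivial_adeleAddCharAt F v)).comp_continuous
    (continuous_const.mul continuous_id)

/-- **the `κ`-shifted local smooth Schrödinger model** `ρ_{v,κ}` of `H(𝕎_v)` on `𝒮(F_vᴺ)`:
`(ρ((x,y),t)Φ)(u) = ψ_v(κ (t + ⟨u, 𝕋_v y⟩)) Φ(u + x)` — the model of `localSchrodinger` with `ψ_v` replaced by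
`ψ_v(κ ·)`. [cite: MoeglinVignerasWaldspurger1987, Chap. 2 I.4 Exemple (1)] -/
def localSchrodingerMulShift (κ : v.adicCompletion F) :
    Representation ℂ (Heisenberg (polar (localPairing F N T v))) (SchwartzBruhat (Fin N → v.adicCompletion F)) :=
  schrodingerSB (localPairing F N T v) ((adeleAddCharAt F v).mulShift κ)
    (isLocallyConstant_adeleAddCharAt_mulShift F v κ) (continuous_localPairing_left' F N T v)

/-- unfolding (every choice of the two proof arguments of `schrodingerSB` gives the same representation, by proof
irrelevance — stated so that consumers may rewrite freely). [cite: MoeglinVignerasWaldspurger1987, Chap. 2 I.4 Exemple (1)] -/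
theorem localSchrodingerMulShift_eq (κ : v.adicCompletion F)
    (hl : IsLocallyConstant (⇑((adeleAddCharAt F v).mulShift κ) : v.adicCompletion F → Circle))
    (hb : ∀ y : Fin N → v.adicCompletion F, Continuous fun u : Fin N → v.adicCompletion F => localPairing F N T v u y) :
    localSchrodingerMulShift F N T v κ = schrodingerSB (localPairing F N T v) ((adeleAddCharAt F v).mulShift κ) hl hb :=
  rfl

/-- pointwise formula of the shifted model. [cite: MoeglinVignerasWaldspurger1987, Chap. 2 I.4 Exemple (1)] -/
theorem localSchrodingerMulShift_apply (κ : v.adicCompletion F) (h : Heisenberg (polar (localPairing F N T v)))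
    (f : SchwartzBruhat (Fin N → v.adicCompletion F)) (u : Fin N → v.adicCompletion F) :
    ((localSchrodingerMulShift F N T v κ h f : SchwartzBruhat (Fin N → v.adicCompletion F)) :
        (Fin N → v.adicCompletion F) → ℂ) u =
      ((adeleAddCharAt F v (κ * (h.t + localPairing F N T v u h.v.2)) : Circle) : ℂ) *
        (f : (Fin N → v.adicCompletion F) → ℂ) (u + h.v.1) := by
  rw [localSchrodingerMulShift, schrodingerSB_apply, AddChar.mulShift_apply]

/-- **the group of pairs of the shifted package** `S̃p_{ψ_v(κ·)}(𝕎_v)`. [cite: MoeglinVignerasWaldspurger1987, Chap. 2 II.1 (B)] -/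
abbrev LocalMpMulShift (κ : v.adicCompletion F) : Type := MpPsi (localSchrodingerMulShift F N T v κ)

/-! ## §2 The twist `S̃p_{ψ_v}(𝕎_v) →* S̃p_{ψ_v(κ·)}(𝕎_v)` -/

section Twist

variable (τ τ' : ℂ →+* ℂ) (hττ' : ∀ z, τ (τ' z) = z) (hτ'τ : ∀ z, τ' (τ z) = z) (κ : v.adicCompletion F)
  (hκ : ∀ r : v.adicCompletion F, τ ((adeleAddCharAt F v r : Circle) : ℂ) = ((adeleAddCharAt F v (κ * r) : Circle) : ℂ))

include hκ in
/-- the hypothesis `τ ∘ ψ_v = ψ_v(κ·)` in the `mulShift` currency of `SchrodingerGaloisTwist`. [folklore] -/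
private theorem hκ' (r : v.adicCompletion F) :
    τ ((adeleAddCharAt F v r : Circle) : ℂ) = (((adeleAddCharAt F v).mulShift κ r : Circle) : ℂ) := by
  rw [AddChar.mulShift_apply]; exact hκ r

/-- **the Galois twist of the local metaplectic group of pairs**: `(g, M) ↦ (g, τ ∘ M ∘ τ')`,
`S̃p_{ψ_v}(𝕎_v) →* S̃p_{ψ_v(κ·)}(𝕎_v)` (`HeisenbergGroup.MpPsi.galTwist` at the local package).
[cite: MoeglinVignerasWaldspurger1987, Chap. 2 II.1 (B)] -/
abbrev LocalMp.galTwist : LocalMp F N T v →* LocalMpMulShift F N T v κ :=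
  MpPsi.galTwist (localPairing F N T v) (adeleAddCharAt F v) ((adeleAddCharAt F v).mulShift κ)
    (isLocallyConstant_of_isContinuousNontrivial (isContinuousNontrivial_adeleAddCharAt F v))
    (isLocallyConstant_adeleAddCharAt_mulShift F v κ) (continuous_localPairing_left' F N T v) τ τ' hττ' hτ'τ
    (hκ' F v τ κ hκ)

/-- **over the identity of `Sp(𝕎_v)`**: `proj (galTwist p) = proj p`. [cite: MoeglinVignerasWaldspurger1987, Chap. 2 II.1 (B)] -/
@[simp] theorem LocalMp.proj_galTwist (p : LocalMp F N T v) :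
    MpPsi.proj _ (LocalMp.galTwist F N T v τ τ' hττ' hτ'τ κ hκ p) = MpPsi.proj _ p :=
  MpPsi.proj_galTwist _ _ _ _ _ _ τ τ' hττ' hτ'τ _ p

/-- the operator component of the twisted pair is the sandwich `τ ∘ M ∘ τ'`. [cite: MoeglinVignerasWaldspurger1987, Chap. 2 II.1 (B)] -/
theorem LocalMp.toRep_galTwist_apply (p : LocalMp F N T v) (f : SchwartzBruhat (Fin N → v.adicCompletion F)) :
    MpPsi.toRep _ (LocalMp.galTwist F N T v τ τ' hττ' hτ'τ κ hκ p) f =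
      schwartzGalConj τ (MpPsi.toRep _ p (schwartzGalConj τ' f)) :=
  MpPsi.toRep_galTwist_apply _ _ _ _ _ _ τ τ' hττ' hτ'τ _ p f

/-- **`ω(galTwist p)(τ ∘ f) = τ ∘ (ω(p) f)`**. [cite: MoeglinVignerasWaldspurger1987, Chap. 2 II.1 (B)] -/
theorem LocalMp.toRep_galTwist_schwartzGalConj (p : LocalMp F N T v)
    (f : SchwartzBruhat (Fin N → v.adicCompletion F)) :
    MpPsi.toRep _ (LocalMp.galTwist F N T v τ τ' hττ' hτ'τ κ hκ p) (schwartzGalConj τ f) =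
      schwartzGalConj τ (MpPsi.toRep _ p f) :=
  MpPsi.toRep_galTwist_schwartzGalConj _ _ _ _ _ _ τ τ' hττ' hτ'τ _ p f

/-- the local twist is bijective (inverse: the twist of the shifted package along `(τ', τ)`).
[cite: MoeglinVignerasWaldspurger1987, Chap. 2 II.1 (B)] -/
theorem LocalMp.galTwist_bijective : Function.Bijective (LocalMp.galTwist F N T v τ τ' hττ' hτ'τ κ hκ) :=
  MpPsi.galTwist_bijective _ _ _ _ _ _ τ τ' hττ' hτ'τ _

/-! ## §3 Twisting a splitting of `U(J)(F_v)` over `ι_v` -/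

variable (E : Type) [Field E] [NumberField E] [Algebra F E] [Algebra.IsQuadraticExtension F E] (c : E ≃ₐ[F] E)
  {δ : E} (hcδ : c δ = -δ) (hδ : δ ≠ 0) {d : F} (hd : δ * δ = algebraMap F E d) (hT : T.IsSymm)
  {J : Matrix (Fin N) (Fin N) E} (hJ : J = T.map (algebraMap F E))

/-- **the twisted splitting lies over `ι_v`**: if `s` is over `ι_v` then so is `galTwist ∘ s`.
[cite: MoeglinVignerasWaldspurger1987, Chap. 2 II.1 (B)] -/
theorem proj_galTwist_comp_eq_iota (s : UnitaryGroup.localPi E c N J v →* LocalMp F N T v)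
    (hs : ∀ g, MpPsi.proj _ (s g) = iota F E c N hcδ hδ hd T hT hJ v g) (g : UnitaryGroup.localPi E c N J v) :
    MpPsi.proj _ ((LocalMp.galTwist F N T v τ τ' hττ' hτ'τ κ hκ).comp s g) = iota F E c N hcδ hδ hd T hT hJ v g := by
  rw [MonoidHom.comp_apply, LocalMp.proj_galTwist, hs]

/-- **the Weil representation of the twisted splitting is the `τ`-twist of `ω_s`**:
`ω_{galTwist∘s}(g)(τ ∘ f) = τ ∘ (ω_s(g) f)`. [cite: MoeglinVignerasWaldspurger1987, Chap. 2 II.1 (B)] -/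
theorem toRep_galTwist_comp_apply' {G : Type*} [Group G] (s : G →* LocalMp F N T v) (g : G)
    (f : SchwartzBruhat (Fin N → v.adicCompletion F)) :
    (MpPsi.toRep (localSchrodingerMulShift F N T v κ)).comp ((LocalMp.galTwist F N T v τ τ' hττ' hτ'τ κ hκ).comp s) g
        (schwartzGalConj τ f) =
      schwartzGalConj τ ((MpPsi.toRep (localSchrodinger F N T v)).comp s g f) :=
  MpPsi.toRep_galTwist_comp_apply _ _ _ _ _ _ τ τ' hττ' hτ'τ _ s g f

/-- the same with the twisted vector on the right: `ω_{galTwist∘s}(g) f = τ ∘ (ω_s(g) (τ' ∘ f))`.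
[cite: MoeglinVignerasWaldspurger1987, Chap. 2 II.1 (B)] -/
theorem toRep_galTwist_comp_apply'' {G : Type*} [Group G] (s : G →* LocalMp F N T v) (g : G)
    (f : SchwartzBruhat (Fin N → v.adicCompletion F)) :
    (MpPsi.toRep (localSchrodingerMulShift F N T v κ)).comp ((LocalMp.galTwist F N T v τ τ' hττ' hτ'τ κ hκ).comp s) g f =
      schwartzGalConj τ ((MpPsi.toRep (localSchrodinger F N T v)).comp s g (schwartzGalConj τ' f)) := by
  rw [MonoidHom.comp_apply, MonoidHom.comp_apply, MonoidHom.comp_apply]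
  exact LocalMp.toRep_galTwist_apply F N T v τ τ' hττ' hτ'τ κ hκ (s g) f

/-- **smoothness of the twisted splitting**: if `ω_s` is smooth then so is `ω_{galTwist∘s}` (same stabilisers on
`τ ∘ f ↔ f`). [cite: MoeglinVignerasWaldspurger1987, Chap. 2 II.8] -/
theorem isSmooth_galTwist_comp' {G : Type*} [Group G] [TopologicalSpace G] (s : G →* LocalMp F N T v)
    (hsm : Representation.IsSmooth ((MpPsi.toRep (localSchrodinger F N T v)).comp s)) :
    Representation.IsSmooth
      ((MpPsi.toRep (localSchrodingerMulShift F N T v κ)).comp ((LocalMp.galTwist F N T v τ τ' hττ' hτ'τ κ hκ).comp s)) :=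
  MpPsi.isSmooth_galTwist_comp _ _ _ _ _ _ τ τ' hττ' hτ'τ _ s hsm

include τ' hττ' hτ'τ hκ in
/-- **SUMMARY — the `σ`-twist of a smooth splitting datum over `ι_v` at `ψ_v` is a smooth splitting datum over
`ι_v` at `ψ_v(κ·)`, with Weil representation conjugate to the old one by `f ↦ τ ∘ f`**: existence form for consumers
that quantify over splittings. [cite: MoeglinVignerasWaldspurger1987, Chap. 2 II.1 (B), II.8] -/
theorem exists_galTwist_splitting (s : UnitaryGroup.localPi E c N J v →* LocalMp F N T v)
    (hs : ∀ g, MpPsi.proj _ (s g) = iota F E c N hcδ hδ hd T hT hJ v g)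
    (hsm : Representation.IsSmooth ((MpPsi.toRep (localSchrodinger F N T v)).comp s)) :
    ∃ s' : UnitaryGroup.localPi E c N J v →* LocalMpMulShift F N T v κ,
      (∀ g, MpPsi.proj _ (s' g) = iota F E c N hcδ hδ hd T hT hJ v g) ∧
      Representation.IsSmooth ((MpPsi.toRep (localSchrodingerMulShift F N T v κ)).comp s') ∧
      ∀ g f, (MpPsi.toRep (localSchrodingerMulShift F N T v κ)).comp s' g (schwartzGalConj τ f) =
        schwartzGalConj τ ((MpPsi.toRep (localSchrodinger F N T v)).comp s g f) :=
  ⟨(LocalMp.galTwist F N T v τ τ' hττ' hτ'τ κ hκ).comp s,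
    proj_galTwist_comp_eq_iota F N T v τ τ' hττ' hτ'τ κ hκ E c hcδ hδ hd hT hJ s hs,
    isSmooth_galTwist_comp' F N T v τ τ' hττ' hτ'τ κ hκ s hsm,
    fun g f => toRep_galTwist_comp_apply' F N T v τ τ' hττ' hτ'τ κ hκ s g f⟩

end Twist

end Literature.NumberTheory.GelbartRogawski1991.UnitaryDualPair.LocalSplitting

end
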